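import Literature.AlgebraicGeometry.Resolution.OrderReductionThreefoldsAlgClosed
import Literature.AlgebraicGeometry.Resolution.ExcellentRings
import HarnessLib

/-!
# Cutkosky 2009, Theorem 6.1 / Remark 6.2: order reduction for an ideal on a nonsingular surface over ANY field, and the two procedural steps of its proof (named facts)

Topic: `Literature/AlgebraicGeometry/Resolution`. NAMED FACTS, statements only, transcribing §6
"Resolution on a surface" of S. D. Cutkosky, *Resolution of singularities for 3-folds in positive
characteristic*, Amer. J. Math. **131** (2009) 59–127 [Cutkosky2009] (held author version
`paper:doi-10-1353-ajm-0-0036`; "pNN Lmm" = page, line of its text layer), p19 L44 – p20 L86: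

> "In this section, we prove resolution for an ideal sheaf on a nonsingular surface. We define a
> resolution datum on a nonsingular variety over an arbitrary field in the same way as for
> algebraically closed fields.
> **Theorem 6.1.** Suppose that `T` is a nonsingular surface over a field `L`, and `R = (∅, E, I, T)`
> is a resolution datum. Let `r = ν(R) ≥ 1`. Then there exists a sequence of permissible transforms
> `π : T_1 → T` of `R` such that `Sing_r(R_1) = ∅`, where `R_1` is the transform of `R` by `π`.
> *Proof.* After a few blow ups of points on the strict transforms of components of `E`, we
> construct `T_1 → T` such that `η(p) = 0` for all `p ∈ Sing_r(R_1)`. We may thus assume that this is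
> true on `T`. Suppose that `C ⊂ Sing_r(I)` is a curve. Then `C` is nonsingular, and there exists a
> neighborhood `U` of `C` in `T` such that `I | 𝒪_U = I_C^r | U`. Let `π_1 : T_1 → T` be the blow up
> of `C`, `I_1` be the weak transform of `I` on `T_1`. Then `I_1 | π_1⁻¹(U) = 𝒪_{π⁻¹(U)}`. Thus
> `Sing_r(I_1) ∩ π⁻¹(U) = ∅`. We thus reduce to the case where `Sing_r(I)` is a finite set of points.
> Now the proof is an extension of the proof of Theorem 3.15 [C2]. We outline the proof here, and
> refer to [C2] for technical details. We construct a sequence of projective morphisms (5)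
> `⋯ → T_n → ⋯ → T_1 → T_0 = T` where each `π_{n+1} : T_{n+1} → T_n` is the blow up of all points in
> `Sing_r(I_n)`, where `I_n` is the weak transform of `I_{n−1}` on `T_n`. We must show that this
> sequence is finite. Suppose that (5) has infinite length. [… the invariant `δ_{p_i} ∈ (1/r!)ℕ` with
> `δ_{p_i} = δ_{p_{i−1}} − 1` along a chain of points `p_n ∈ Sing_r(I_n)`, `π_n(p_n) = p_{n−1}` …] a
> contradiction to our assumption that (5) has infinite length.
> **Remark 6.2.** Theorem 6.1 and its proof are applicable when `T = Spec(A)`, where `A` is an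
> excellent 2 dimensional regular local ring containing a field."

("[C2]" = S. D. Cutkosky, *Resolution of Singularities*, Grad. Stud. Math. 63, AMS 2004.) Conventions
as in `OrderReductionThreefoldsAlgClosed.lean` (`Cutkosky2009_thm_5_6`, the 3-fold twin): resolution
datum Def. 5.4 ↔ marked ideal `(I, E, r)` of `MarkedIdeals.lean`, `Sing_r` ↔ `MarkedIdeal.support`,
permissible transform Def. 5.5 / weak transform ↔ the admissible blow-ups and controlled transform
(exponent `r`) of `IsMarkedResolution`, "surface over `L`" ↔ an integral `L`-scheme immersed in some
`ℙⁿ_L` with all local rings regular and `dim = 2` (p16 L12–14), `ν` ↔ `idealOrder`.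

## Contents

* Settings (definitions): `Cutkosky2009.IsSurfaceOverField T` (Thm. 6.1), and
  `Cutkosky2009.IsExcellentRegularLocalSurfaceSpec T` (Rem. 6.2: `T ≅ Spec A`, `A` an excellent
  regular local ring of Krull dimension `2` containing a field).
* `Cutkosky2009_thm_6_1` — NAMED FACT, Thm. 6.1 (∃ a marked resolution of `(I, E, r)`), and
  `Cutkosky2009_rem_6_2` — the same for `T = Spec A` as in Rem. 6.2.
* `Cutkosky2009_thm_6_1_curveStep` — NAMED FACT, the curve step of the proof (p19 L55–58), SINGLE
  STEP: a curve `C ⊆ Sing_r(I)` (with `ν ≤ r` everywhere) is nonsingular, `I = 𝓘_C^r` on a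
  neighbourhood `U ⊇ C`, and after blowing up `C` the weak transform is the unit ideal over `U`.
  [proof-internal]
* `Cutkosky2009.AllPointsRun r` (definition: the sequence (5) — at each stage `Sing_r(I_n)` is a
  finite nonempty set of closed points, `T_{n+1} → T_n` is a blow-up of all of them, `I_{n+1}` the weak
  (= controlled, exponent `r`) transform) and `Cutkosky2009_thm_6_1_noInfiniteAllPointsRun` — NAMED
  FACT, "(5) is finite": no such infinite sequence starts at `(I, r)` with `ν ≤ r` on a `T` as in 6.1
  or 6.2. [proof-internal; details deferred by print to [C2] Thm. 3.15]

## Faithfulness notes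

* 6.1 / 6.2 are stated in the ∃-shape of `Cutkosky2009_thm_5_6` (`IsMarkedResolution`); the two
  procedural facts are sentences of the PROOF (print: "We outline the proof here, and refer to [C2]
  for technical details"), admitted in both printed settings (6.1's surface over a field; 6.2's
  `Spec A`, "Theorem 6.1 and its proof are applicable"). The preliminary step "after a few blow ups
  of points … `η(p) = 0`" (∃, unspecified) and the boundary play no role in the two procedural
  sentences as printed and are not hypotheses of them; the all-points sequence (5) presupposes
  "`Sing_r(I)` is a finite set of points" (a field of `AllPointsRun`).
* Nothing here restates Thm. 5.6 / 7.2 or the 3-fold vocabulary; the uses of 6.1/6.2 inside the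
  proof of Thm. 7.2 (p21 L46, p22 L1–5, L27–30, p24 L33–36) are typed where they occur
  (`ThreefoldResolutionStableFormPhases.lean`, `ThreefoldResolutionAlgorithms.lean`).
* AI transcription; AI review is weaker than expert review.
-/

noncomputable section

open CategoryTheory AlgebraicGeometry TopologicalSpace IsLocalRing

namespace Literature.AlgebraicGeometry.Resolution

universe u

namespace Cutkosky2009

/-- **The setting of Thm. 6.1: "`T` is a nonsingular surface over a field `L`"** (p19 L47; "variety"
= open subset of an integral closed subscheme of `ℙⁿ`, p16 L12–14): for some field `L` and some `n`,
`T` is an integral scheme immersed in `ℙⁿ_L`, with all local rings regular, of dimension `2`.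
[cite: Cutkosky2009, Thm. 6.1 (p. 19 l. 47) with p. 16 l. 12–14] -/
def IsSurfaceOverField (T : Scheme.{u}) : Prop :=
  ∃ (L : Type u) (_ : Field L) (n : ℕ) (ι : T ⟶ (Motives.projectiveSpace n L).left),
    IsImmersion ι ∧ IsIntegral T ∧ Scheme.IsRegular T ∧ topologicalKrullDim T = 2

/-- **The setting of Remark 6.2: "`T = Spec(A)`, where `A` is an excellent 2 dimensional regular local
ring containing a field"** (p20 L85–86). [cite: Cutkosky2009, Rem. 6.2 (p. 20 l. 85–86)] -/
def IsExcellentRegularLocalSurfaceSpec (T : Scheme.{u}) : Prop :=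
  ∃ (A : CommRingCat.{u}), IsRegularLocalRing A ∧ IsExcellentRing A ∧ ringKrullDim A = 2 ∧
    (∃ (K : Type u) (_ : Field K), Nonempty (K →+* A)) ∧ Nonempty (T ≅ Spec A)

/-- `Sing_r(I) = {x | ν_x(I) ≥ r}` for an ideal sheaf and a natural number (the support of the marked
ideal `(I, E, r)`, whatever `E`). [cite: Cutkosky2009, Def. 5.4 (p. 18 l. 36–40)] -/
def singSet (X : Scheme.{u}) (I : X.IdealSheafData) (r : ℕ) : Set X :=
  {x | (r : ℕ∞) ≤ idealOrder I x}

/-- `Sing_r(I)` is the support of the marked ideal `(I, E, r)`. [cite: Cutkosky2009, Def. 5.4 (p. 18 l. 36–40)] -/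
theorem singSet_eq_support (X : Scheme.{u}) (I : X.IdealSheafData) (E : List X.IdealSheafData) (r : ℕ) :
    singSet X I r = (⟨I, E, r⟩ : MarkedIdeal X).support := rfl

/-- The reduced closed subscheme structure on (the closure of) `Sing_r(I)` — the centre "all points in
`Sing_r(I_n)`" of the sequence (5) when `Sing_r(I_n)` is a finite set of closed points (then closed).
[cite: Cutkosky2009, proof of Thm. 6.1 (p. 20 l. 44–46)] -/
def allPointsIdeal (X : Scheme.{u}) (I : X.IdealSheafData) (r : ℕ) : X.IdealSheafData :=
  AlgebraicGeometry.Scheme.IdealSheafData.vanishingIdeal ⟨closure (singSet X I r), isClosed_closure⟩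

/-- **The sequence (5) of the proof of Thm. 6.1, of infinite length** (p20 L42–48): "`⋯ → T_n → ⋯ →
T_1 → T_0 = T` where each `π_{n+1} : T_{n+1} → T_n` is the blow up of all points in `Sing_r(I_n)`, where
`I_n` is the weak transform of `I_{n−1}` on `T_n`", in the situation "`Sing_r(I)` is a finite set of
points" (p20 L45) reproduced at every stage, the sequence never stopping (`Sing_r(I_n) ≠ ∅`).
[cite: Cutkosky2009, proof of Thm. 6.1 (p. 20 l. 42–48)] -/
structure AllPointsRun (r : ℕ) where
  /-- the surfaces `T_n` -/
  T : ℕ → Scheme.{u}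
  /-- the weak transforms `I_n` -/
  I : ∀ n, (T n).IdealSheafData
  /-- the blow-ups `π_{n+1} : T_{n+1} → T_n` -/
  map : ∀ n, T (n + 1) ⟶ T n
  /-- `Sing_r(I_n)` is a finite set … -/
  finite : ∀ n, (singSet (T n) (I n) r).Finite
  /-- … of closed points … -/
  closed : ∀ n, ∀ x ∈ singSet (T n) (I n) r, IsClosed ({x} : Set (T n))
  /-- … and is nonempty (the sequence does not stop) -/
  nonempty : ∀ n, (singSet (T n) (I n) r).Nonempty
  /-- `π_{n+1}` is a blow-up of all points of `Sing_r(I_n)` (reduced) -/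
  isBlowup : ∀ n, IsBlowup (map n) (allPointsIdeal (T n) (I n) r)
  /-- `I_{n+1}` is the weak transform of `I_n` (controlled transform with exponent `r`) -/
  weak : ∀ n, I (n + 1) = controlledTransform (map n) (allPointsIdeal (T n) (I n) r) (I n) r

end Cutkosky2009

/-! ## Theorem 6.1 and Remark 6.2 (∃-form) -/

/-- NAMED FACT — **Cutkosky 2009, Theorem 6.1** (p19 L47–50): "Suppose that `T` is a nonsingular
surface over a field `L`, and `R = (∅, E, I, T)` is a resolution datum. Let `r = ν(R) ≥ 1`. Then there
exists a sequence of permissible transforms `π : T_1 → T` of `R` such that `Sing_r(R_1) = ∅`, where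
`R_1` is the transform of `R` by `π`." Rendered in the shape of `Cutkosky2009_thm_5_6`: for every
field `L` (any characteristic, not necessarily perfect), every integral `L`-scheme `T` immersed in some
`ℙⁿ_L` with all local rings regular and `dim T = 2`, every snc boundary `E`, every ideal sheaf `I ≠ 0`
and every `r ≥ 1` with `ν_x(I) ≤ r` everywhere, the marked ideal `(I, E, r)` admits a marked
resolution. Users take `(h : Cutkosky2009_thm_6_1)`.
[cite: Cutkosky2009, Thm. 6.1 (author version p. 19 l. 47–50)] -/
def Cutkosky2009_thm_6_1 : Prop :=
  ∀ (T : Scheme.{u}), Cutkosky2009.IsSurfaceOverField T →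
    ∀ (E : List T.IdealSheafData), HasSNC E →
    ∀ (I : T.IdealSheafData), I ≠ ⊥ → ∀ (r : ℕ), 1 ≤ r → (∀ x : T, idealOrder I x ≤ r) →
      ∃ (T' : Scheme.{u}) (π : T' ⟶ T) (R' : MarkedIdeal T'),
        IsMarkedResolution (⟨I, E, r⟩ : MarkedIdeal T) π R'

/-- NAMED FACT — **Cutkosky 2009, Remark 6.2** (p20 L85–86): "Theorem 6.1 and its proof are
applicable when `T = Spec(A)`, where `A` is an excellent 2 dimensional regular local ring containing a
field." Rendered: the conclusion of `Cutkosky2009_thm_6_1` for such `T`.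
Users take `(h : Cutkosky2009_rem_6_2)`.
[cite: Cutkosky2009, Rem. 6.2 (author version p. 20 l. 85–86)] -/
def Cutkosky2009_rem_6_2 : Prop :=
  ∀ (T : Scheme.{u}), Cutkosky2009.IsExcellentRegularLocalSurfaceSpec T →
    ∀ (E : List T.IdealSheafData), HasSNC E →
    ∀ (I : T.IdealSheafData), I ≠ ⊥ → ∀ (r : ℕ), 1 ≤ r → (∀ x : T, idealOrder I x ≤ r) →
      ∃ (T' : Scheme.{u}) (π : T' ⟶ T) (R' : MarkedIdeal T'),
        IsMarkedResolution (⟨I, E, r⟩ : MarkedIdeal T) π R'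

/-! ## The two procedural sentences of the proof -/

/-- NAMED FACT — **Cutkosky 2009, proof of Thm. 6.1, the curve step** (p19 L55–58; [proof-internal]):
"Suppose that `C ⊂ Sing_r(I)` is a curve. Then `C` is nonsingular, and there exists a neighborhood `U`
of `C` in `T` such that `I | 𝒪_U = I_C^r | U`. Let `π_1 : T_1 → T` be the blow up of `C`, `I_1` be the
weak transform of `I` on `T_1`. Then `I_1 | π_1⁻¹(U) = 𝒪_{π⁻¹(U)}`. Thus `Sing_r(I_1) ∩ π⁻¹(U) = ∅`."
(`T` as in Thm. 6.1 or Rem. 6.2; `r = ν(R)`, rendered "`ν ≤ r` everywhere", `r ≥ 1`.) Rendered, SINGLE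
STEP: for an irreducible closed curve `C ⊆ Sing_r(I)`, (i) the reduced subscheme on `C` is regular,
(ii) on some open `U ⊇ C` the stalks of `I` are the `r`-th powers of the stalks of `𝓘_C`, and
(iii) along any blow-up `π` of `𝓘_C` the weak transform (controlled transform, exponent `r`) has unit
stalks over `U`. Users take `(h : Cutkosky2009_thm_6_1_curveStep)`.
[cite: Cutkosky2009, proof of Thm. 6.1 (author version p. 19 l. 55–58)] -/
def Cutkosky2009_thm_6_1_curveStep : Prop :=
  ∀ (T : Scheme.{u}),
    (Cutkosky2009.IsSurfaceOverField T ∨ Cutkosky2009.IsExcellentRegularLocalSurfaceSpec T) →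
    ∀ (I : T.IdealSheafData), I ≠ ⊥ → ∀ (r : ℕ), 1 ≤ r → (∀ x : T, idealOrder I x ≤ r) →
    ∀ (C : Closeds T), IsIrreducible (C : Set T) → topologicalKrullDim C = 1 →
      (C : Set T) ⊆ Cutkosky2009.singSet T I r →
      Scheme.IsRegular (AlgebraicGeometry.Scheme.IdealSheafData.vanishingIdeal C).subscheme ∧
        ∃ U : T.Opens, (C : Set T) ⊆ (U : Set T) ∧
          (∀ x ∈ (U : Set T), stalkIdeal I x =
            stalkIdeal (AlgebraicGeometry.Scheme.IdealSheafData.vanishingIdeal C) x ^ r) ∧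
          ∀ (T' : Scheme.{u}) (π : T' ⟶ T),
            IsBlowup π (AlgebraicGeometry.Scheme.IdealSheafData.vanishingIdeal C) →
              ∀ x' : T', π.base x' ∈ (U : Set T) →
                stalkIdeal (controlledTransform π
                  (AlgebraicGeometry.Scheme.IdealSheafData.vanishingIdeal C) I r) x' = ⊤

/-- NAMED FACT — **Cutkosky 2009, proof of Thm. 6.1, the all-points sequence (5) is finite** (p20
L42–84; [proof-internal; details deferred by print to [C2] Thm. 3.15]): "We construct a sequence of
projective morphisms (5) … where each `π_{n+1} : T_{n+1} → T_n` is the blow up of all points in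
`Sing_r(I_n)`, where `I_n` is the weak transform of `I_{n−1}` on `T_n`. We must show that this sequence
is finite. Suppose that (5) has infinite length. … a contradiction to our assumption that (5) has
infinite length." (Situation: "`Sing_r(I)` is a finite set of points", p20 L45; `T` as in Thm. 6.1 or
Rem. 6.2; `r = ν(R) ≥ 1`.) Rendered: there is no `AllPointsRun r` (at every stage `Sing_r(I_n)` a finite
nonempty set of closed points, all blown up, weak transforms) starting at an ideal `I ≠ 0` with
`ν ≤ r` everywhere on such a `T`. Users take `(h : Cutkosky2009_thm_6_1_noInfiniteAllPointsRun)`.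
[cite: Cutkosky2009, proof of Thm. 6.1 (author version p. 20 l. 42–84)] -/
def Cutkosky2009_thm_6_1_noInfiniteAllPointsRun : Prop :=
  ∀ (r : ℕ), 1 ≤ r → ∀ (ρ : Cutkosky2009.AllPointsRun.{u} r),
    (Cutkosky2009.IsSurfaceOverField (ρ.T 0) ∨ Cutkosky2009.IsExcellentRegularLocalSurfaceSpec (ρ.T 0)) →
    ρ.I 0 ≠ ⊥ → (∀ x : ρ.T 0, idealOrder (ρ.I 0) x ≤ r) → False

/-! ## Proved consequences -/

namespace Cutkosky2009_thm_6_1_noInfiniteAllPointsRun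

/-- **`IsEmpty` form** of the finiteness of (5). [cite: Cutkosky2009, proof of Thm. 6.1 (p. 20 l. 42–48)] -/
theorem isEmpty_run (h : Cutkosky2009_thm_6_1_noInfiniteAllPointsRun.{u}) (T : Scheme.{u})
    (hT : Cutkosky2009.IsSurfaceOverField T ∨ Cutkosky2009.IsExcellentRegularLocalSurfaceSpec T)
    (I : T.IdealSheafData) (hI : I ≠ ⊥) (r : ℕ) (hr : 1 ≤ r) (hν : ∀ x : T, idealOrder I x ≤ r) :
    IsEmpty {ρ : Cutkosky2009.AllPointsRun.{u} r // ∃ e : ρ.T 0 = T, e ▸ ρ.I 0 = I} := by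
  refine ⟨fun ⟨ρ, e, hI0⟩ => ?_⟩
  subst e
  subst hI0
  exact h r hr ρ hT hI hν

end Cutkosky2009_thm_6_1_noInfiniteAllPointsRun

namespace Cutkosky2009_thm_6_1

/-- The case `ν < r` everywhere is trivial (the identity is a marked resolution), as for Thm. 5.6.
[cite: Cutkosky2009, Thm. 6.1 (p. 19 l. 47–50), case `Sing_r = ∅`] -/
theorem conclusion_of_forall_lt {T : Scheme.{u}} (I : T.IdealSheafData) (E : List T.IdealSheafData)
    {r : ℕ} (h : ∀ x : T, idealOrder I x < r) :
    ∃ (T' : Scheme.{u}) (π : T' ⟶ T) (R' : MarkedIdeal T'),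
      IsMarkedResolution (⟨I, E, r⟩ : MarkedIdeal T) π R' :=
  Cutkosky2009_thm_5_6.conclusion_of_forall_lt I E h

end Cutkosky2009_thm_6_1

end Literature.AlgebraicGeometry.Resolution

end
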